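import Literature.AlgebraicGeometry.Frobenioids.ArithmeticFrobenioidDivisorTransport
import HarnessLib

/-!
# Frobenioids I, Theorem 6.4 (iii) at `C_{K/F}`: the Cor. 4.11 data of `Ψ' : (C₁^pf)^un-tr ⥲ (C₂^pf)^un-tr`
# and the perfected transport `θ_{A₁}` JOINTLY (row «T64iii-ARBITRARY-Ψ′», θ-side adapter for the knit)

Mochizuki, *The geometry of Frobenioids I: the general theory*, Kyushu J. Math. **62** (2008) 293–400, §6,
Thm. 6.4 (iii) pp. 114–115 ("the bijection `V(L₁) ⥲ Prime(Φ₁(L₁)) ⥲ Prime(Φ₂(L₂)) ⥲ V(L₂)` induced by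
`(Ψ^pf)^un-tr` [cf. (i); Corollary 4.11, (iii)]"), Cor. 4.11 (ii)–(iv) pp. 91–92.
[cite: MochizukiFrdI2008, Thm. 6.4 (iii) p.114]

PROOF-ONLY companion (abc-iut-L1-d1 gen 4). `ArithmeticFrobenioidDivisorTransport.lean` (gen 3, p428043) states
the Cor. 4.11 (ii)–(iv) data `(Ψ'^Base, Ψ'^Φ, η')` of `Ψ'` (`exists_divisorTransport_pfUntr_arith`) and the
transport at an object `θ_{A₁} : Φ₁(L₁)^pf ⥲ Φ₂(L₂)^pf` (`exists_perfectedDivisorTransport_pfUntr_at_arith`) as two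
SEPARATE existentials; the assembler of Thm. 6.4 (iii) for an arbitrary `Ψ'` (abc-iut-L1-t3) needs them
TOGETHER with the defining relation `θ_{A₁} = (η'_{A₁})^* ∘ Ψ'^Φ_{L₁}` — which is how `θ_{A₁}` is built. This
file states the JOINT package (`exists_divisorTransport_pfUntr_joint_arith`): one existential carrying
`Ψ'^Base` (its `1`-unique base square), `Ψ'^Φ` (natural along pull-backs), `η'`, `θ_{A₁}`, `Ψ'` preserving
Frobenius degrees, `Div(Ψ' φ) = η'^* Ψ'^Φ(Div φ)`, `θ_{A₁} m = η'_{A₁}^* (Ψ'^Φ_{L₁} m)` for ALL `m`, and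
`θ_{A₁}(Div φ) = Div(Ψ' φ)`. No definitions; nothing here bears on [IUTchIII] Cor. 3.12.
-/

noncomputable section

namespace Literature.AlgebraicGeometry.Frobenioids

open CategoryTheory Opposite
open PreFrobenioid

section Arith

variable {F₁ : Type} [Field F₁] [NumberField F₁] {K₁ : Type} [Field K₁] [Algebra F₁ K₁] [IsGalois F₁ K₁]
variable {F₂ : Type} [Field F₂] [NumberField F₂] {K₂ : Type} [Field K₂] [Algebra F₂ K₂] [IsGalois F₂ K₂]

/-- **Cor. 4.11 (ii)–(iv) data of `Ψ' : (C_{K₁/F₁}^pf)^un-tr ⥲ (C_{K₂/F₂}^pf)^un-tr` JOINTLY with the transport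
`θ_{A₁}` at an object** (Thm. 6.4 (iii), "`A₂ = (Ψ^pf)^un-tr(A₁)` [whose projection to `D_i` we denote by
`Spec(L_i)`] … the bijection … induced by [the equivalence] [cf. Corollary 4.11, (iii)]", p. 115): `Ψ'^Base`
with its `1`-unique base square, `η' : Base₂ ∘ Ψ' ≅ Ψ'^Base ∘ Base₁`, `Ψ'^Φ : Φ₁^pf ⥲ Φ₂^pf` over `Ψ'^Base`
natural along pull-backs, `Ψ'` preserving Frobenius degrees, `Div(Ψ' φ) = η'_A^* Ψ'^Φ(Div φ)`; and
`θ_{A₁} : Φ₁(L₁)^pf ⥲ Φ₂(L₂)^pf`, `L₁ := Base A₁`, `L₂ := Base (Ψ' A₁)`, DEFINED as `η'_{A₁}^* ∘ Ψ'^Φ_{L₁}` (clause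
`hθE`) and hence carrying `Div(φ)` to `Div(Ψ' φ)` for every `φ : A₁ → B₁` (clause `hθdiv`).
[cite: MochizukiFrdI2008, Thm. 6.4 (iii) p.115] -/
theorem exists_divisorTransport_pfUntr_joint_arith
    (Ψ' : (PreFrobenioidData.ofFunctor _
        (PreFrobenioid.Perfection.ops (arithFrobenioid_isFrobenioid F₁ K₁)).toFunctor).Untr ≌
      (PreFrobenioidData.ofFunctor _
        (PreFrobenioid.Perfection.ops (arithFrobenioid_isFrobenioid F₂ K₂)).toFunctor).Untr)
    (A₁ : (PreFrobenioidData.ofFunctor _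
      (PreFrobenioid.Perfection.ops (arithFrobenioid_isFrobenioid F₁ K₁)).toFunctor).Untr) :
    ∃ (ΨBase : FinSubextCat F₁ K₁ ⥤ FinSubextCat F₂ K₂)
      (E : (PreFrobenioidData.ofFunctor _ (untrFunctor (arith_pf_isFrobenioid F₁ K₁))).DivisorMonoidIsoOverBase
        (PreFrobenioidData.ofFunctor _ (untrFunctor (arith_pf_isFrobenioid F₂ K₂))) ΨBase)
      (η : Ψ'.functor ⋙ (PreFrobenioidData.ofFunctor _ (untrFunctor (arith_pf_isFrobenioid F₂ K₂))).base ≅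
        (PreFrobenioidData.ofFunctor _ (untrFunctor (arith_pf_isFrobenioid F₁ K₁))).base ⋙ ΨBase)
      (θ : Perfection (Multiplicative (EffArithDivisor
          ((PreFrobenioidData.ofFunctor _ (untrFunctor (arith_pf_isFrobenioid F₁ K₁))).base.obj A₁).L)) ≃*
        Perfection (Multiplicative (EffArithDivisor
          ((PreFrobenioidData.ofFunctor _ (untrFunctor (arith_pf_isFrobenioid F₂ K₂))).base.obj
            (Ψ'.functor.obj A₁)).L))),
      PreFrobenioidData.OneUniqueSquare Ψ'.functor
          (PreFrobenioidData.ofFunctor _ (untrFunctor (arith_pf_isFrobenioid F₁ K₁))).base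
          (PreFrobenioidData.ofFunctor _ (untrFunctor (arith_pf_isFrobenioid F₂ K₂))).base ΨBase ∧
        PreFrobenioidData.PreservesDegFr
          (PreFrobenioidData.ofFunctor _ (untrFunctor (arith_pf_isFrobenioid F₁ K₁)))
          (PreFrobenioidData.ofFunctor _ (untrFunctor (arith_pf_isFrobenioid F₂ K₂))) Ψ' ∧
        (∀ ⦃A B : (PreFrobenioidData.ofFunctor _
            (PreFrobenioid.Perfection.ops (arithFrobenioid_isFrobenioid F₁ K₁)).toFunctor).Untr⦄ (φ : A ⟶ B),
          (PreFrobenioidData.ofFunctor _ (untrFunctor (arith_pf_isFrobenioid F₂ K₂))).div (Ψ'.functor.map φ) =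
            (PreFrobenioidData.ofFunctor _ (untrFunctor (arith_pf_isFrobenioid F₂ K₂))).pull (η.hom.app A)
              (E.iso ((PreFrobenioidData.ofFunctor _ (untrFunctor (arith_pf_isFrobenioid F₁ K₁))).base.obj A)
                ((PreFrobenioidData.ofFunctor _ (untrFunctor (arith_pf_isFrobenioid F₁ K₁))).div φ))) ∧
        (∀ ⦃X Y : FinSubextCat F₁ K₁⦄ (f : Y ⟶ X)
          (x : (PreFrobenioidData.ofFunctor _ (untrFunctor (arith_pf_isFrobenioid F₁ K₁))).Mon X),
          E.iso Y ((PreFrobenioidData.ofFunctor _ (untrFunctor (arith_pf_isFrobenioid F₁ K₁))).pull f x) =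
            (PreFrobenioidData.ofFunctor _ (untrFunctor (arith_pf_isFrobenioid F₂ K₂))).pull (ΨBase.map f)
              (E.iso X x)) ∧
        (∀ m, θ m =
          (PreFrobenioidData.ofFunctor _ (untrFunctor (arith_pf_isFrobenioid F₂ K₂))).pull (η.hom.app A₁)
            (E.iso ((PreFrobenioidData.ofFunctor _ (untrFunctor (arith_pf_isFrobenioid F₁ K₁))).base.obj A₁) m)) ∧
        ∀ ⦃B₁ : (PreFrobenioidData.ofFunctor _
            (PreFrobenioid.Perfection.ops (arithFrobenioid_isFrobenioid F₁ K₁)).toFunctor).Untr⦄ (φ : A₁ ⟶ B₁),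
          θ ((PreFrobenioidData.ofFunctor _ (untrFunctor (arith_pf_isFrobenioid F₁ K₁))).div φ) =
            (PreFrobenioidData.ofFunctor _ (untrFunctor (arith_pf_isFrobenioid F₂ K₂))).div (Ψ'.functor.map φ) := by
  have H := exists_divisorTransport_pfUntr_arith (F₁ := F₁) (K₁ := K₁) (F₂ := F₂) (K₂ := K₂) Ψ'
  obtain ⟨ΨBase, E, η, hsq, hdeg, hdiv, hnat⟩ := H
  let S₂ := PreFrobenioidData.ofFunctor _ (untrFunctor (arith_pf_isFrobenioid F₂ K₂))
  let P := S₂.base.obj (Ψ'.functor.obj A₁)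
  let Q := ΨBase.obj ((PreFrobenioidData.ofFunctor _ (untrFunctor (arith_pf_isFrobenioid F₁ K₁))).base.obj A₁)
  let g : P ≅ Q := η.app A₁
  -- the pull-back along the isomorphism `η'_{A₁}` as a multiplicative equivalence (as in p428043)
  have h₁ : (S₂.pull g.inv).comp (S₂.pull g.hom) = MonoidHom.id _ := by
    refine MonoidHom.ext fun x => ?_
    rw [MonoidHom.comp_apply, ← S₂.pull_comp, Iso.inv_hom_id, S₂.pull_id]
    rfl
  have h₂ : (S₂.pull g.hom).comp (S₂.pull g.inv) = MonoidHom.id _ := by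
    refine MonoidHom.ext fun x => ?_
    rw [MonoidHom.comp_apply, ← S₂.pull_comp, Iso.hom_inv_id, S₂.pull_id]
    rfl
  let e : S₂.Mon Q ≃* S₂.Mon P := MonoidHom.toMulEquiv (S₂.pull g.hom) (S₂.pull g.inv) h₁ h₂
  refine ⟨ΨBase, E, η,
    (E.iso ((PreFrobenioidData.ofFunctor _ (untrFunctor (arith_pf_isFrobenioid F₁ K₁))).base.obj A₁)).trans e,
    hsq, hdeg, hdiv, hnat, ?_, ?_⟩
  · -- `((E.iso _).trans e) m = e (E.iso _ m) = S₂.pull (η.app A₁).hom (E.iso _ m)`: all by `rfl`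
    intro m
    rfl
  · intro B₁ φ
    exact (hdiv φ).symm

end Arith

end Literature.AlgebraicGeometry.Frobenioids

end
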